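import Literature.Computability.FineGrained.SETHHardness
import Literature.Computability.FineGrained.CliqueETHLiberalReduction
import Literature.Computability.FineGrained.CliqueETHMachineModel
import Literature.Computability.FineGrained.SparsificationAlgorithm
import Literature.Computability.FineGrained.CliqueETHTMBridge
import Literature.Computability.FineGrained.KSatTranscoder
import Literature.Computability.Cryptography.TM2ToWordRAMMachine
import Literature.Computability.FineGrained.DomSetSETHReductionProgram
import Literature.Computability.FineGrained.KOVFromSETH
import Literature.Computability.FineGrained.OneSATProgram
import HarnessLib

/-!
# Word-RAM SETH: status of `SETHWordRAM` and robustness of its statement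

Companion to `Literature.Computability.FineGrained.SETHHardness`.

**`Literature.Computability.FineGrained.SETHWordRAM` is a hypothesis, not a theorem.** Calabro–Impagliazzo–Paturi
(*The complexity of satisfiability of small depth circuits*, IWPEC 2009, §1) introduce it as
follows: "Let `s_k = inf{c | ∃ a randomized algorithm for k-SAT with time complexity poly(m)2^{cn}
for k-CNF formulas of size m over n variables}` … We know that the sequence `{s_k}` has a limit and
let `s_∞` denote this limit. [IP01] proposed the open question whether `s_∞ = 1`, which we will call
the Strongly Exponential-Time Hypothesis (SETH). The best known upper bounds for `s_k` are all of
the form `1 − 1/O(k)`, which makes the conjecture SETH plausible." It is an open conjecture (a proof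
would separate P from NP), so there is deliberately **no** `SETHWordRAM_holds`; dependents take
`(h : SETHWordRAM)`. The vendored form is the *deterministic* word-RAM one (VVW ICM 2018, §3,
Hypothesis 1), which is implied by — hence weaker than — the randomized form of CIP 2009.

This file records, sorry-free, that the side condition `3 ≤ k` in `SETHWordRAM` is immaterial
(`sethWordRAM_iff`), via antitonicity of `KSATInRAMTime k δ` in `k` (`KSATInRAMTime.anti`), so
that the definition reads literally as `s_∞ = 1`: for every `ε > 0` some `k`-SAT has no
deterministic `O(2^{(1-ε)n})`-time word-RAM algorithm.

**Discharge of `Literature.Computability.FineGrained.not_kClique_inTimeInst_of_eth`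
(fine-grained.S23; Chen–Huang–Kanj–Xia, JCSS 72 (2006), Thm. 5.5).**
`not_kClique_inTimeInst_of_eth_holds` assembles the Turing-machine route of
`CliqueETHTMBridge.lean` / `CliqueETHLiberalReduction.lean` (`not_kClique_inTimeInst_of_eth_of_tm'`):
the grouping reduction of Chen–Huang–Kanj–Xia on the word RAM
(`liberalSparseKSATInRAMTime_of_kCliqueInTimeNLittleOK_holds`), the change of machine model
(`sparseKSATInExpTime_of_liberalSparseKSATInRAMTime_holds`, `CliqueETHMachineModel.lean`) and the
sparsification lemma of Impagliazzo–Paturi–Zane on multi-stack machines (`sparsification_holds`,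
`SparsificationAlgorithm.lean`). The fact thereby becomes an unconditional theorem of the tree.
-/

namespace Literature.Computability.FineGrained


/-- An algorithm for `k'`-SAT is an algorithm for `k`-SAT when `k ≤ k'`: a `k`-CNF is a `k'`-CNF,
and `kSATProblem k`, `kSATProblem k'` are restrictions of the same `CNFSAT` (same encoding, size,
width and accepted outputs), so the same program with the same constants works. Hence
`KSATInRAMTime k δ` is antitone in `k` (the word-RAM counterpart of the monotonicity of `s_k` in
`k`, Impagliazzo–Paturi, JCSS 62 (2001), §1). [folklore] -/
theorem KSATInRAMTime.anti {k k' : ℕ} {δ : ℝ} (h : KSATInRAMTime k' δ) (hk : k ≤ k') :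
    KSATInRAMTime k δ := by
  obtain ⟨M, c, C, hdet, hof, hM⟩ := h
  refine ⟨M, c, C, hdet, hof, fun φ => ?_⟩
  have hφ : φ.1 ∈ {ψ : Literature.Computability.Complexity.CNF ℕ | Literature.Computability.Complexity.CNF.IsWidthLE k' ψ ∧ List.Nodup ψ} :=
    ⟨fun cl hcl => (φ.2.1 cl hcl).trans hk, φ.2.2⟩
  exact hM ⟨φ.1, hφ⟩

/-- The side condition `3 ≤ k` in `SETHWordRAM` is immaterial: word-RAM SETH is equivalent to
"for every `ε > 0` there is *some* `k` such that `k`-SAT has no deterministic `O(2^{(1-ε)n})`-time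
word-RAM algorithm" (if `k` works, so does `max k 3`, by `KSATInRAMTime.anti`). This is the
`s_∞ = 1` reading of SETH of Calabro–Impagliazzo–Paturi, IWPEC 2009, §1 (stated there as an open
question / conjecture). [folklore] -/
theorem sethWordRAM_iff :
    SETHWordRAM ↔ ∀ ε : ℝ, 0 < ε → ∃ k : ℕ, ¬ KSATInRAMTime k (1 - ε) := by
  refine ⟨fun h ε hε => ?_, fun h ε hε => ?_⟩
  · obtain ⟨k, -, hk⟩ := h ε hε
    exact ⟨k, hk⟩
  · obtain ⟨k, hk⟩ := h ε hε
    exact ⟨max k 3, le_max_right _ _, fun h' => hk (h'.anti (le_max_left _ _))⟩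

/-- **fine-grained.S23, discharged** (Chen–Huang–Kanj–Xia, *Strong computational lower bounds via
parameterized complexity*, JCSS 72 (2006), Thm. 5.5, p. 1360: CLIQUE is `W_l[1]`-hard, hence has no
`f(k) · m^{o(k)}`-time algorithm for any function `f` unless all problems in SNP are solvable in
subexponential time — in particular unless 3-SAT is in time `2^{o(n)}`, i.e. unless ETH fails).
Assuming Wave0's Turing-machine `ETH`, `k`-Clique has no `f(k) · n^{o(k)}`-time word-RAM algorithm.
Proof: the Turing-machine route `not_kClique_inTimeInst_of_eth_of_tm'` fed with the sparsification
lemma (`sparsification_holds`, Impagliazzo–Paturi–Zane 2001, Thm. 1 / Cor. 1) and the change of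
machine model (`sparseKSATInExpTime_of_liberalSparseKSATInRAMTime_holds`, Cook–Reckhow 1973, §2);
the word-RAM grouping reduction (Lemma 2.2 / Thm. 5.5 of the source) is
`liberalSparseKSATInRAMTime_of_kCliqueInTimeNLittleOK_holds`.
[cite: ChenHuangKanjXiaJCSS2006, Thm. 5.5 (p. 1360)] -/
theorem not_kClique_inTimeInst_of_eth_holds : not_kClique_inTimeInst_of_eth :=
  not_kClique_inTimeInst_of_eth_of_tm' sparsification_holds
    sparseKSATInExpTime_of_liberalSparseKSATInRAMTime_holds

end Literature.Computability.FineGrained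

/-!
## Discharge of `seth_of_sethWordRAM` and `kSATInRAMTime_of_kSATInExpTime` (appended)

**`seth_of_sethWordRAM_holds : SETHWordRAM → SETH`** and
**`kSATInRAMTime_of_kSATInExpTime_holds`** (VVW ICM 2018, §2: "All hypotheses are about the
word-RAM model of computation with `O(log n)` bit words"; the direction "a fast Turing-machine
algorithm is a fast word-RAM algorithm" is folklore — Papadimitriou, *Computational Complexity*
(1994), §2.6; Cook–Reckhow, JCSS 7 (1973), §2 — and is proved here at machine level):

* a Turing-machine (`Turing.FinTM2`) `k`-SAT decider with time `c · 2^{δ n} · (L+1)^c`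
  (`KSATInExpTime k δ`, Wave0) is turned into a word-RAM program for `kSATProblem k`
  (`SETHBridge.prog`): relocate the input (`SProg.relocate`), transcode the `CNFSAT` word encoding
  into the machine's string encoding (`KSatTranscoder.transcode`), simulate the machine with
  constant overhead per step (`TM2Emu.simProgram`, `TM2ToWordRAMMachine.lean`), read the answer
  (`SETHBridge.prog_exec`);
* the running time is `O(2^{δ' n})` for every `δ' > δ ≥ 0` with `Θ(n)`-bit words
  (`kSATInRAMTime_of_kSATInExpTime_of_nonneg`): without repeated clauses a `k`-CNF on `n` variables
  has `≤ (2(n+1))^{k+1}` clauses (`numClauses_le_of_nodup`), so all sizes are polynomial in `n`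
  (`kSAT_size_bounds`, scale `scaleP n k = (2(n+1))^{k+3}`), the word size `k' · (n + width)` holds
  every address (`SETHBridge.word_bounds`), and `poly(n) · 2^{δ n} ≤ C · 2^{δ' n}`
  (`time_le_const_mul_two_rpow`, via `exists_pow_le_two_rpow`);
* negative exponents are vacuous (`not_kSATInExpTime_of_neg`), which completes the named fact for
  all `δ < δ'`; `seth_of_sethWordRAM_holds` applies word-RAM SETH at `ε' = min (ε/2) (1/2)`.
-/
namespace Literature.Computability.FineGrained

open _root_.Computability Turing Real Cryptography Cryptography.WordRAM Cryptography.WordRAM.SProg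
  Complexity

-- The finiteness fields of a bundled `FinTM2` are instance-implicit structure fields, not global
-- instances (Mathlib registers only `decidableEqK`/`inhabitedσ`); they are made available locally,
-- exactly as `letI := tm.ΛFin` does in `TM2Window.lean`/`TimeBoundsProofs.lean`. No library
-- instance is overridden (the carriers `tm.K`, `tm.Λ`, `tm.σ`, `tm.Γ tm.k₀` have no other instances).
attribute [local instance] Turing.FinTM2.kFin Turing.FinTM2.ΛFin Turing.FinTM2.σFin
  Turing.FinTM2.Γk₀Fin

/-! ### From a clause list to Wave0's `KCNF` -/

/-- The `k`-CNF of Wave0 (`KCNF k`: clause list with all variables below `numVars`) of a clause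
list of width `≤ k`, on `numVars φ` variables. [folklore] -/
def toKCNF (k : ℕ) (φ : CNF ℕ) (hw : φ.IsWidthLE k) : KCNF k where
  numVars := φ.numVars
  clauses := φ
  fst_lt_numVars := fun _ hc _ hl => CliqueRed.lt_numVars_of_mem hc hl
  length_le := hw

/-- `toKCNF` has the same satisfiability. [folklore] -/
theorem toKCNF_satisfiable_iff {k : ℕ} (φ : CNF ℕ) (hw : φ.IsWidthLE k) :
    (toKCNF k φ hw).Satisfiable ↔ φ.Satisfiable := by
  rw [KCNF.satisfiable_iff_exists_eval]; rfl

/-! ### Binary numerals -/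

/-- `encodePosNum p` lists the binary digits of `p`, least significant first. (The same statement
is `Literature.Computability.Cryptography.encodePosNum_eq_bits` of `ShorClassicalOracle.lean`,
whose import closure — Shor's algorithm — is foreign to this file; the fifteen-line proof is
repeated rather than imported. A librarian may move both copies to a common home.) [folklore] -/
theorem encodePosNum_eq_natBits (p : PosNum) : encodePosNum p = (p : ℕ).bits := by
  induction p with
  | one => simp [encodePosNum]
  | bit1 p ih => rw [encodePosNum, ih, PosNum.cast_bit1, ← Nat.bit1_bits, two_mul]
  | bit0 p ih =>
    rw [encodePosNum, ih, PosNum.cast_bit0, ← Nat.bit0_bits _ (PosNum.cast_pos p).ne']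
    congr 1; omega

/-- Mathlib's `Computability.encodeNat` is `Nat.bits` (digits least significant first). (Same
statement as `Literature.Computability.Cryptography.encodeNat_eq_bits` of `ShorClassicalOracle.lean`;
see `encodePosNum_eq_natBits` for why it is re-proved here.) [folklore] -/
theorem encodeNat_eq_natBits (n : ℕ) : encodeNat n = n.bits := by
  unfold encodeNat encodeNum
  cases h : (n : Num) with
  | zero =>
    have : n = 0 := by simpa using congrArg (fun m : Num => (m : ℕ)) h
    subst this; simp
  | pos p =>
    have : n = (p : ℕ) := by simpa using congrArg (fun m : Num => (m : ℕ)) h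
    rw [this]; exact encodePosNum_eq_natBits p

/-! ### The program of the bridge -/

namespace SETHBridge

variable (M : TM2ComputableAux Γ' Bool)

/-- The code of an input symbol of the machine. [folklore] -/
noncomputable def codeΓ (γ : Γ') : ℕ := (TM2Emu.enc M.tm).code M.tm.k₀ (M.inputAlphabet.symm γ)

/-- The five symbol codes handed to the transcoder. [folklore] -/
noncomputable def codes : KSatTranscoder.Codes :=
  ⟨codeΓ M (.bit false), codeΓ M (.bit true), codeΓ M .bra, codeΓ M .ket, codeΓ M .comma⟩

/-- The code of an output symbol of the machine. [folklore] -/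
noncomputable def ocode (b : Bool) : ℕ := (TM2Emu.enc M.tm).code M.tm.k₁ (M.outputAlphabet.symm b)

/-- The machine's input on `φ`: its string encoding of `toKCNF k φ`, in the machine's alphabet. [folklore] -/
def inp {k : ℕ} (φ : CNF ℕ) (hw : φ.IsWidthLE k) : List (M.tm.Γ M.tm.k₀) :=
  (KCNF.encode (toKCNF k φ hw)).map M.inputAlphabet.symm

/-- The transcoder produces exactly the codes of the machine's input. [folklore] -/
theorem cnfCodes_eq_map_inp {k : ℕ} (φ : CNF ℕ) (hw : φ.IsWidthLE k) :
    (codes M).cnfCodes φ = (inp M φ hw).map ((TM2Emu.enc M.tm).code M.tm.k₀) := by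
  have hbit : ∀ b, (codes M).bit b = codeΓ M (.bit b) := fun b => by cases b <;> rfl
  have hbits : ∀ v, (codes M).bitsCode v = ((encodeNat v).map Γ'.bit).map (codeΓ M) := fun v => by
    simp [KSatTranscoder.Codes.bitsCode, encodeNat_eq_natBits, hbit]
  have hlit : ∀ l : ℕ × Bool, (codes M).litCodes l = (KCNF.encodeLiteral l).map (codeΓ M) := fun l => by
    simp [KSatTranscoder.Codes.litCodes, KCNF.encodeLiteral, hbits, hbit]; rfl
  have hcl : ∀ c : List (ℕ × Bool), (codes M).clauseCodes c = (KCNF.encodeClause c).map (codeΓ M) :=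
    fun c => by
    simp only [KSatTranscoder.Codes.clauseCodes, KCNF.encodeClause, List.map_cons, List.map_append, List.map_flatMap,
      List.map_nil]
    rw [show (codes M).bra = codeΓ M .bra from rfl, show (codes M).ket = codeΓ M .ket from rfl]
    congr 2
    exact List.flatMap_congr fun l _ => hlit l
  simp only [inp, List.map_map, KSatTranscoder.Codes.cnfCodes, KCNF.encode, toKCNF, List.map_append, List.map_cons,
    List.map_flatMap, hbits]
  rw [show (codes M).comma = codeΓ M .comma from rfl]
  congr 2
  · exact List.flatMap_congr fun c _ => (hcl c).trans (by rfl)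

/-- Hand the transcoder's output to the simulator: `r4 := r20` (the base `Q` = end of the code
list), `r10 := r21` (its length), `r11 := r20` (its end address). [folklore] -/
def glueOps : List OpSpec :=
  [(.add, .dir 4, .dir 20, .imm 0), (.add, .dir 10, .dir 21, .imm 0), (.add, .dir 11, .dir 20, .imm 0)]

/-- The answer: `r1 := (r7 = code of the output symbol "true")`, `r0 := 1` (output `[r1]`). [folklore] -/
noncomputable def outOps : List OpSpec :=
  [(.eq, .dir 1, .dir 7, .imm (ocode M true)), (.add, .dir 0, .imm 1, .imm 0)]

/-- **The word-RAM `k`-SAT program obtained from the Turing machine `M`**: relocate the input,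
KSatTranscoder.transcode it into the machine's input string, simulate the machine, read the output symbol. [folklore] -/
noncomputable def prog : SProg :=
  .seq relocate (.seq (KSatTranscoder.transcode (codes M)) (.seq (.block glueOps)
    (.seq (TM2Emu.simProgram M.tm) (.seq (.block (topOps ((TM2Emu.enc M.tm).ι M.tm.k₁)))
      (.block (outOps M))))))

/-- `prog` makes no oracle query. [folklore] -/
theorem prog_queryFree : (prog M).QueryFree := by
  exact ⟨relocate_queryFree, KSatTranscoder.transcode_queryFree _, block_queryFree _, TM2Emu.simProgram_queryFree _,
    block_queryFree _, block_queryFree _⟩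

/-- The running time of `prog` on `φ` when the machine takes `T'` steps: relocation, transcoding,
booting, loading, `T'` simulated steps, and the answer. [folklore] -/
noncomputable def progTime (φ : CNF ℕ) (T' : ℕ) : ℕ :=
  7 * (encodeCNFWords φ).length + KSatTranscoder.transcodeTime φ + 8 + TM2Emu.bootCost M.tm +
    9 * ((codes M).cnfCodes φ).length + T' * ((TM2Emu.enc M.tm).stepCost M.tm.m + 2)

/-- The codes handed to the transcoder are codes of input symbols, hence at most `γ`. [folklore] -/
theorem codes_sup_le : (codes M).sup ≤ (TM2Emu.enc M.tm).γ := by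
  have h : ∀ γ, codeΓ M γ ≤ (TM2Emu.enc M.tm).γ := fun γ =>
    (TM2Emu.enc_good M.tm).code_le _ _ (TM2Emu.mem_alphabet_k₀ M.tm _)
  simp only [codes, KSatTranscoder.Codes.sup]
  have := h (.bit false); have := h (.bit true); have := h .bra; have := h .ket; have := h .comma
  omega

open scoped Classical in
/-- **Semantics of the bridge program.** If the machine answers on `toKCNF k φ` within `T'` steps,
then `prog M`, started on the `CNFSAT` input `encodeCNFWords φ` at a word size holding the input
width, the relocated input, the transcoded string, the cells of stacks of height
`heightBound |string| T'`, the symbol codes and the dispatch keys, halts within `progTime M φ T'`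
steps with output `[1]` if `φ` is satisfiable and `[0]` otherwise. [folklore] -/
theorem prog_exec {k : ℕ} (φ : CNF ℕ) (hwid : φ.IsWidthLE k) {T' : ℕ}
    (hrun : Nonempty (TM2OutputsInTime M.tm (inp M φ hwid)
      (some ((encodeBool (decide (toKCNF k φ hwid).Satisfiable)).map M.outputAlphabet.symm)) T'))
    {w : ℕ} (hwI : inputWidth (encodeCNFWords φ) ≤ w)
    (hwL : 2 * (encodeCNFWords φ).length + 200 < 2 ^ w)
    (hw : cellAddr (2 * (encodeCNFWords φ).length + 101 + ((codes M).cnfCodes φ).length)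
      (TM2Emu.enc M.tm).κ (TM2Emu.enc M.tm).κ
      (TM2Emu.heightBound M.tm ((codes M).cnfCodes φ).length T') < 2 ^ w)
    (hγ : (TM2Emu.enc M.tm).γ < 2 ^ w) (hkey : TM2Emu.keyBound M.tm < 2 ^ w) :
    ∃ st' : Store, SProg.ExecLE w noOracle (prog M) ⟨(init w (encodeCNFWords φ)).mem, []⟩ st'
        (progTime M φ T') ∧
      readOut st'.mem = [if φ.Satisfiable then 1 else 0] := by
  have hgood : (TM2Emu.enc M.tm).Good (TM2Emu.alphabet M.tm) := TM2Emu.enc_good M.tm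
  -- sizes
  have hL2 : 2 ≤ (encodeCNFWords φ).length := by rw [KSatTranscoder.length_encodeCNFWords]; omega
  have hxw : ∀ v ∈ encodeCNFWords φ, v < 2 ^ w := fun v hv =>
    lt_of_lt_of_le (lt_two_pow_inputWidth_of_mem _ v hv) (Nat.pow_le_pow_right (by norm_num) hwI)
  have hQw : 2 * (encodeCNFWords φ).length + 101 + ((codes M).cnfCodes φ).length +
      (TM2Emu.enc M.tm).κ + (TM2Emu.enc M.tm).κ ≤
      cellAddr (2 * (encodeCNFWords φ).length + 101 + ((codes M).cnfCodes φ).length)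
        (TM2Emu.enc M.tm).κ (TM2Emu.enc M.tm).κ
        (TM2Emu.heightBound M.tm ((codes M).cnfCodes φ).length T') := by
    unfold cellAddr; omega
  have hκ : 0 < (TM2Emu.enc M.tm).κ := hgood.κ_pos
  -- 1. relocation
  have h1 : Exec w noOracle relocate ⟨(init w (encodeCNFWords φ)).mem, []⟩
      ⟨relocated (encodeCNFWords φ), []⟩ (7 * (encodeCNFWords φ).length) := by
    rw [init_mem_eq_initFun hwI]
    exact relocate_exec (by omega) hxw (by omega) []
  -- 2. transcoding
  have hsup : (codes M).sup < 2 ^ w := lt_of_le_of_lt (codes_sup_le M) hγ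
  obtain ⟨R₁, t₁, h2, ht₁, h20, h21⟩ := KSatTranscoder.transcode_exec (O := noOracle) (codes M) hsup φ hxw
    (by omega) hwL []
  -- 3. glue
  have h3 : Exec w noOracle (.block glueOps)
      ⟨merge R₁ (KSatTranscoder.outMem (relocated (encodeCNFWords φ)) (2 * (encodeCNFWords φ).length + 101)
        ((codes M).cnfCodes φ)), []⟩
      ⟨merge (Function.update (Function.update (Function.update R₁ 4
        (2 * (encodeCNFWords φ).length + 101 + ((codes M).cnfCodes φ).length)) 10
        ((codes M).cnfCodes φ).length) 11
        (2 * (encodeCNFWords φ).length + 101 + ((codes M).cnfCodes φ).length))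
        (KSatTranscoder.outMem (relocated (encodeCNFWords φ)) (2 * (encodeCNFWords φ).length + 101)
        ((codes M).cnfCodes φ)), []⟩ 3 := by
    refine Exec.block' _ [] ?_
    simp only [glueOps, execOps_cons, execOps_nil, execOp, Operand.read, Operand.write,
      merge_apply_of_lt (show 20 < 100 by decide), merge_apply_of_lt (show 21 < 100 by decide),
      update_merge_of_lt _ _ (show 4 < 100 by decide), update_merge_of_lt _ _ (show 10 < 100 by decide),
      update_merge_of_lt _ _ (show 11 < 100 by decide), Function.update_of_ne (show (20 : ℕ) ≠ 4 by decide),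
      Function.update_of_ne (show (21 : ℕ) ≠ 4 by decide), Function.update_of_ne (show (20 : ℕ) ≠ 10 by decide),
      h20, h21]
    rw [BinOp.eval_add_of_lt (by omega), BinOp.eval_add_of_lt (by omega)]
    simp only [Nat.add_zero]
  -- 4. the simulation
  have hleny : ((codes M).cnfCodes φ).length = (inp M φ hwid).length := by
    rw [cnfCodes_eq_map_inp M φ hwid, List.length_map]
  have hypos : 1 ≤ ((codes M).cnfCodes φ).length := by
    simp only [KSatTranscoder.Codes.cnfCodes, List.length_append, List.length_cons]; omega
  obtain ⟨R₃, h4, hR₃4, hout⟩ := TM2Emu.simProgram_exec M.tm hrun (w := w) (O := noOracle)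
    (Q := 2 * (encodeCNFWords φ).length + 101 + ((codes M).cnfCodes φ).length)
    (s := 2 * (encodeCNFWords φ).length + 101)
    (R := Function.update (Function.update (Function.update R₁ 4
        (2 * (encodeCNFWords φ).length + 101 + ((codes M).cnfCodes φ).length)) 10
        ((codes M).cnfCodes φ).length) 11
        (2 * (encodeCNFWords φ).length + 101 + ((codes M).cnfCodes φ).length))
    (H := KSatTranscoder.outMem (relocated (encodeCNFWords φ)) (2 * (encodeCNFWords φ).length + 101)
        ((codes M).cnfCodes φ)) [] (by omega) (by omega) (by rw [← hleny]) (by simp)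
    (by simp [hleny]) (by simp [hleny])
    (fun t ht => by
      rw [KSatTranscoder.outMem_add _ _ _ (by rw [hleny]; exact ht),
        List.getElem_of_eq (cnfCodes_eq_map_inp M φ hwid), List.getElem_map])
    (fun a ha => by
      rw [KSatTranscoder.outMem_of_le _ _ (by omega)]
      exact relocated_of_lt _ (by omega))
    (by rwa [← hleny]) hγ hkey
  -- 5. the top of the output stack
  have hstk : (TM2Emu.enc M.tm).stk (haltList M.tm
      ((encodeBool (decide (toKCNF k φ hwid).Satisfiable)).map M.outputAlphabet.symm)).stk =
      Function.update (fun _ => ([] : List ℕ)) ((TM2Emu.enc M.tm).ι M.tm.k₁)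
        [ocode M (decide (toKCNF k φ hwid).Satisfiable)] := by
    rw [TM2Emu.stk_haltList]; rfl
  rw [hstk] at h4
  have hob : M.outputAlphabet.symm (decide (toKCNF k φ hwid).Satisfiable) ∈ TM2Emu.alphabet M.tm M.tm.k₁ :=
    hout _ (by simp [encodeBool])
  have hcode : ocode M (decide (toKCNF k φ hwid).Satisfiable) ≤ (TM2Emu.enc M.tm).γ :=
    hgood.code_le _ _ hob
  have hHb : 1 ≤ TM2Emu.heightBound M.tm ((codes M).cnfCodes φ).length T' := by
    unfold TM2Emu.heightBound; omega
  have h5 := top_exec (O := noOracle) (R := R₃)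
    (G := KSatTranscoder.outMem (relocated (encodeCNFWords φ)) (2 * (encodeCNFWords φ).length + 101)
      ((codes M).cnfCodes φ))
    (S := Function.update (fun _ => ([] : List ℕ)) ((TM2Emu.enc M.tm).ι M.tm.k₁)
      [ocode M (decide (toKCNF k φ hwid).Satisfiable)])
    (i := (TM2Emu.enc M.tm).ι M.tm.k₁) hR₃4 (by omega) (hgood.ι_lt _)
    (by
      rw [Function.update_self, List.length_singleton]
      exact lt_of_lt_of_le (Enc.cellAddr_lt_cellAddr (hgood.ι_lt _) hHb) hw.le)
    (by rw [Function.update_self]; simp only [List.headD_cons]; omega) []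
  rw [Function.update_self] at h5
  simp only [List.length_singleton, List.headD_cons] at h5
  -- 6. the answer
  set R₄ : ℕ → ℕ := Function.update (Function.update (Function.update R₃ 5
    (2 * (encodeCNFWords φ).length + 101 + ((codes M).cnfCodes φ).length + (TM2Emu.enc M.tm).ι M.tm.k₁))
    6 (cellAddr (2 * (encodeCNFWords φ).length + 101 + ((codes M).cnfCodes φ).length)
      (TM2Emu.enc M.tm).κ ((TM2Emu.enc M.tm).ι M.tm.k₁) 1)) 7
    (ocode M (decide (toKCNF k φ hwid).Satisfiable)) with hR₄
  have h6 : ∀ D : ℕ → ℕ, Exec w noOracle (.block (outOps M)) ⟨merge R₄ D, []⟩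
      ⟨merge (Function.update (Function.update R₄ 1
        (if ocode M (decide (toKCNF k φ hwid).Satisfiable) = ocode M true then 1 else 0)) 0 1) D, []⟩ 2 := by
    intro D
    refine Exec.block' _ [] ?_
    simp only [outOps, execOps_cons, execOps_nil, execOp, Operand.read, Operand.write,
      merge_apply_of_lt (show 7 < 100 by decide), update_merge_of_lt _ _ (show 1 < 100 by decide),
      update_merge_of_lt _ _ (show 0 < 100 by decide), BinOp.eval_eq, hR₄, Function.update_self]
    rw [BinOp.eval_add_of_lt (by omega)]
  -- assembling
  have hfin := h1.execLE.seq (h2.execLE.seq (h3.execLE.seq (h4.seq (h5.execLE.seq (h6 _).execLE))))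
  refine ⟨_, hfin.mono ?_, ?_⟩
  · unfold progTime; omega
  · -- the output
    simp only [readOut]
    rw [merge_apply_of_lt (show 0 < 100 by decide), Function.update_self]
    simp only [readSeg, List.range_one, List.map_cons, List.map_nil, Nat.add_zero,
      merge_apply_of_lt (show 1 < 100 by decide)]
    rw [Function.update_of_ne (by decide), Function.update_self]
    have hiff : ocode M (decide (toKCNF k φ hwid).Satisfiable) = ocode M true ↔ φ.Satisfiable := by
      rw [eq_comm, ocode, ocode, TM2Emu.code_eq_code_iff M.tm hob, Equiv.apply_eq_iff_eq, eq_comm,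
        decide_eq_true_iff, toKCNF_satisfiable_iff]
    by_cases hs : φ.Satisfiable
    · simp [hs, hiff.2 hs]
    · have : ¬ ocode M (decide (toKCNF k φ hwid).Satisfiable) = ocode M true := fun h => hs (hiff.1 h)
      simp [hs, this]

end SETHBridge

/-! ### Size bounds for `k`-CNFs without repeated clauses -/

/-- A literal with variable below `n` as an element of the finite type `Fin n × Bool`. [folklore] -/
def litOpt (n : ℕ) (l : Literal ℕ) : Option (Fin n × Bool) :=
  if h : l.1 < n then some (⟨l.1, h⟩, l.2) else none

/-- `litOpt` is injective on literals with variables below `n`. [folklore] -/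
theorem litOpt_inj {n : ℕ} {l l' : Literal ℕ} (hl : l.1 < n) (h : litOpt n l = litOpt n l') :
    l = l' := by
  unfold litOpt at h
  rw [dif_pos hl] at h
  by_cases hl' : l'.1 < n
  · rw [dif_pos hl', Option.some.injEq, Prod.mk.injEq, Fin.mk.injEq] at h
    exact Prod.ext h.1 h.2
  · rw [dif_neg hl'] at h; cases h

/-- `litOpt` of a literal with variable below `n` is not `none`. [folklore] -/
theorem litOpt_ne_none {n : ℕ} {l : Literal ℕ} (hl : l.1 < n) : litOpt n l ≠ none := by
  unfold litOpt; rw [dif_pos hl]; exact Option.some_ne_none _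

/-- **Counting clauses.** A list of pairwise distinct clauses of width `≤ k` over the variables
`< n = numVars` has at most `(2 (n + 1))^{k+1}` clauses: a clause is determined by the function
`Fin (k+1) → Option (Fin n × Bool)` of its entries. [folklore] -/
theorem numClauses_le_of_nodup {k : ℕ} {φ : CNF ℕ} (hw : φ.IsWidthLE k) (hnd : φ.Nodup) :
    φ.numClauses ≤ (2 * (φ.numVars + 1)) ^ (k + 1) := by
  classical
  let f : Clause ℕ → (Fin (k + 1) → Option (Fin φ.numVars × Bool)) := fun c j =>
    if h : (j : ℕ) < c.length then litOpt φ.numVars (c.get ⟨j, h⟩) else none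
  have hf : ∀ (c : Clause ℕ) (j : Fin (k + 1)) (hj : (j : ℕ) < c.length),
      f c j = litOpt φ.numVars (c.get ⟨j, hj⟩) := fun c j hj => by simp only [f, dif_pos hj]
  have hnone : ∀ (c : Clause ℕ) (j : Fin (k + 1)), c.length ≤ (j : ℕ) → f c j = none :=
    fun c j hj => by simp only [f, dif_neg (Nat.not_lt.2 hj)]
  have hinj : ∀ (c : Clause ℕ), c ∈ φ → ∀ (c' : Clause ℕ), c' ∈ φ → f c = f c' → c = c' := by
    intro c hc c' hc' h
    have hlc := hw c hc
    have hlc' := hw c' hc'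
    have hlen : c.length = c'.length := by
      by_contra hne
      rcases Nat.lt_or_gt_of_ne hne with hlt | hlt
      · have h1 := hnone c ⟨c.length, by omega⟩ le_rfl
        have h2 := hf c' ⟨c.length, by omega⟩ hlt
        rw [h] at h1; rw [h1] at h2
        exact litOpt_ne_none (CliqueRed.lt_numVars_of_mem hc' (List.get_mem _ _)) h2.symm
      · have h1 := hnone c' ⟨c'.length, by omega⟩ le_rfl
        have h2 := hf c ⟨c'.length, by omega⟩ hlt
        rw [← h] at h1; rw [h1] at h2
        exact litOpt_ne_none (CliqueRed.lt_numVars_of_mem hc (List.get_mem _ _)) h2.symm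
    refine List.ext_get hlen fun j hj hj' => ?_
    have h1 := hf c ⟨j, by omega⟩ hj
    have h2 := hf c' ⟨j, by omega⟩ hj'
    rw [h, h2] at h1
    exact litOpt_inj (CliqueRed.lt_numVars_of_mem hc (List.get_mem _ _)) h1.symm
  have hnd' : (φ.map f).Nodup := hnd.map_on hinj
  have hcard := hnd'.length_le_card
  rw [List.length_map] at hcard
  refine hcard.trans ?_
  simp only [Fintype.card_fun, Fintype.card_fin, Fintype.card_option, Fintype.card_prod,
    Fintype.card_bool]
  exact Nat.pow_le_pow_left (by omega) _

/-- The size of a CNF of width `≤ k` is at most `k` per clause. [folklore] -/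
theorem size_le_of_isWidthLE {k : ℕ} {φ : CNF ℕ} (hw : φ.IsWidthLE k) :
    φ.size ≤ φ.numClauses * k := by
  unfold CNF.size CNF.numClauses
  have := List.sum_le_card_nsmul (φ.map List.length) k (fun x hx => by
    obtain ⟨c, hc, rfl⟩ := List.mem_map.1 hx; exact hw c hc)
  simpa using this

/-- The clause words: one per clause plus one per literal. [folklore] -/
theorem length_clauseWords : ∀ φ : CNF ℕ,
    (KSatTranscoder.clauseWords φ).length = φ.numClauses + φ.size
  | [] => by simp [KSatTranscoder.clauseWords, CNF.numClauses, CNF.size]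
  | c :: φ => by
    rw [KSatTranscoder.clauseWords_cons, List.length_append, List.length_cons, List.length_map,
      length_clauseWords φ]
    simp [CNF.numClauses, CNF.size]; omega

/-- A number has at most itself many binary digits. [folklore] -/
theorem length_natBits_le_self (v : ℕ) : v.bits.length ≤ v := by
  rw [Nat.size_eq_bits_len]; exact Nat.size_le.2 (Nat.lt_two_pow_self)

/-- The length of the code list of a clause with variables `< n`. [folklore] -/
theorem length_flatMap_litCodes_le (C : KSatTranscoder.Codes) {n : ℕ} {c : Clause ℕ} (h : ∀ l ∈ c, l.1 < n) :
    (c.flatMap C.litCodes).length ≤ c.length * (n + 2) := by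
  have hl : ∀ l ∈ c, (C.litCodes l).length ≤ n + 2 := fun l hlc => by
    have h1 := length_natBits_le_self l.1
    have h2 := h l hlc
    simp only [KSatTranscoder.Codes.litCodes, KSatTranscoder.Codes.bitsCode, List.length_cons, List.length_append, List.length_map,
      List.length_nil]
    omega
  rw [List.length_flatMap]
  have := List.sum_le_card_nsmul (c.map fun l => (C.litCodes l).length) (n + 2)
    (fun x hx => by obtain ⟨l, hlc, rfl⟩ := List.mem_map.1 hx; exact hl l hlc)
  simpa using this

/-- The length of the transcoded string of a clause list with variables `< n`. [folklore] -/
theorem length_flatMap_clauseCodes_le (C : KSatTranscoder.Codes) {n : ℕ} : ∀ (φ : CNF ℕ),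
    (∀ c ∈ φ, ∀ l ∈ c, l.1 < n) →
    (φ.flatMap C.clauseCodes).length ≤ 2 * φ.length + (φ.map List.length).sum * (n + 2)
  | [], _ => by simp
  | c :: φ, h => by
    have ih := length_flatMap_clauseCodes_le C φ fun c' hc' => h c' (by simp [hc'])
    have hc := length_flatMap_litCodes_le C (c := c) (h c (by simp))
    have hcl : (C.clauseCodes c).length = (c.flatMap C.litCodes).length + 2 := by
      simp [KSatTranscoder.Codes.clauseCodes]
    rw [List.flatMap_cons, List.length_append, hcl, List.length_cons, List.map_cons, List.sum_cons,
      Nat.add_mul]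
    omega

/-- The length of the transcoded string. [folklore] -/
theorem length_cnfCodes_le (C : KSatTranscoder.Codes) (φ : CNF ℕ) :
    (C.cnfCodes φ).length ≤ φ.numVars + 1 + 2 * φ.numClauses + φ.size * (φ.numVars + 2) := by
  have h1 := length_flatMap_clauseCodes_le C φ fun c hc l hl => CliqueRed.lt_numVars_of_mem hc hl
  have h2 := length_natBits_le_self φ.numVars
  have hlen : (C.cnfCodes φ).length = φ.numVars.bits.length + 1 + (φ.flatMap C.clauseCodes).length := by
    simp only [KSatTranscoder.Codes.cnfCodes, List.length_append, List.length_cons, KSatTranscoder.Codes.bitsCode, List.length_map]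
    omega
  rw [hlen]
  unfold CNF.numClauses CNF.size
  omega

/-- The time of the transcoder. [folklore] -/
theorem transcodeTime_le (φ : CNF ℕ) :
    KSatTranscoder.transcodeTime φ ≤ 14 + 9 * φ.numVars + φ.numClauses * 12 + φ.size * (16 + 9 * φ.numVars) := by
  have h1 := KSatTranscoder.clauseTime_le (B := φ.numVars) (cs := φ) fun c hc l hl =>
    (length_natBits_le_self l.1).trans (CliqueRed.lt_numVars_of_mem hc hl).le
  have h2 := length_natBits_le_self φ.numVars
  unfold KSatTranscoder.transcodeTime
  have : (φ.map List.length).sum = φ.size := rfl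
  rw [this] at h1
  have : φ.length = φ.numClauses := rfl
  rw [this] at h1
  have := Nat.mul_le_mul_left 9 h2
  omega

/-- The polynomial scale of all sizes of a `k`-SAT instance on `n` variables: `(2(n+1))^{k+3}`. [folklore] -/
def scaleP (n k : ℕ) : ℕ := (2 * (n + 1)) ^ (k + 3)

/-- Basic inequalities of the scale. [folklore] -/
theorem scaleP_facts (n k : ℕ) {m : ℕ} (hm : m ≤ (2 * (n + 1)) ^ (k + 1)) :
    1 ≤ scaleP n k ∧ n + 1 ≤ scaleP n k ∧ m * (2 * (n + 1)) ^ 2 ≤ scaleP n k := by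
  have h2 : 1 ≤ 2 * (n + 1) := by omega
  refine ⟨Nat.one_le_pow _ _ (by omega), ?_, ?_⟩
  · calc n + 1 ≤ 2 * (n + 1) := by omega
      _ = (2 * (n + 1)) ^ 1 := (pow_one _).symm
      _ ≤ (2 * (n + 1)) ^ (k + 3) := Nat.pow_le_pow_right h2 (by omega)
  · calc m * (2 * (n + 1)) ^ 2 ≤ (2 * (n + 1)) ^ (k + 1) * (2 * (n + 1)) ^ 2 :=
          Nat.mul_le_mul_right _ hm
      _ = (2 * (n + 1)) ^ (k + 3) := by rw [← pow_add]

/-- **The size bounds of a `k`-SAT instance** without repeated clauses, in the scale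
`P = (2(n+1))^{k+3}`: input length `≤ (k+3) P`, transcoded length `+ 1 ≤ (k+5) P`, transcoding time
`≤ (35 + 25 k) P`. [folklore] -/
theorem kSAT_size_bounds {k : ℕ} {φ : CNF ℕ} (hw : φ.IsWidthLE k) (hnd : φ.Nodup) (C : KSatTranscoder.Codes) :
    (encodeCNFWords φ).length ≤ (k + 3) * scaleP φ.numVars k ∧
    (C.cnfCodes φ).length + 1 ≤ (k + 5) * scaleP φ.numVars k ∧
    KSatTranscoder.transcodeTime φ ≤ (35 + 25 * k) * scaleP φ.numVars k := by
  have hm := numClauses_le_of_nodup hw hnd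
  obtain ⟨hP1, hNP, hmP⟩ := scaleP_facts φ.numVars k hm
  set P := scaleP φ.numVars k with hP
  set n := φ.numVars with hn
  set m := φ.numClauses with hmdef
  have hS := size_le_of_isWidthLE hw
  rw [← hmdef] at hS
  set S := φ.size with hSdef
  have hL : (encodeCNFWords φ).length = m + S + 2 := by
    rw [KSatTranscoder.length_encodeCNFWords, length_clauseWords]
  have hy := length_cnfCodes_le C φ
  have ht := transcodeTime_le φ
  rw [← hn, ← hmdef, ← hSdef] at hy ht
  -- the elementary products
  have hsq : (2 * (n + 1)) ^ 2 = 4 * (n + 1) * (n + 1) := by ring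
  rw [hsq] at hmP
  have h4 : n + 2 ≤ 4 * (n + 1) * (n + 1) := by nlinarith [Nat.zero_le n]
  have h25 : 16 + 9 * n ≤ 4 * (n + 1) * (n + 1) * 4 := by nlinarith [Nat.zero_le n]
  have hmN : m * (n + 2) ≤ P := le_trans (Nat.mul_le_mul_left m h4) hmP
  have hm1 : m ≤ P := le_trans (Nat.le_mul_of_pos_right m (by omega)) hmN
  have hm25 : m * (16 + 9 * n) ≤ 4 * P := by
    calc m * (16 + 9 * n) ≤ m * (4 * (n + 1) * (n + 1) * 4) := Nat.mul_le_mul_left m h25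
      _ = m * (4 * (n + 1) * (n + 1)) * 4 := by ring
      _ ≤ P * 4 := Nat.mul_le_mul_right 4 hmP
      _ = 4 * P := by ring
  have hSN : S * (n + 2) ≤ k * P := by
    calc S * (n + 2) ≤ m * k * (n + 2) := Nat.mul_le_mul_right _ hS
      _ = k * (m * (n + 2)) := by ring
      _ ≤ k * P := Nat.mul_le_mul_left k hmN
  have hSN' : S * (16 + 9 * n) ≤ 4 * (k * P) := by
    calc S * (16 + 9 * n) ≤ m * k * (16 + 9 * n) := Nat.mul_le_mul_right _ hS
      _ = k * (m * (16 + 9 * n)) := by ring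
      _ ≤ k * (4 * P) := Nat.mul_le_mul_left k hm25
      _ = 4 * (k * P) := by ring
  have hS1 : S ≤ k * P := le_trans (Nat.le_mul_of_pos_right S (by omega)) hSN
  have e1 : (k + 3) * P = k * P + 3 * P := by ring
  have e2 : (k + 5) * P = k * P + 5 * P := by ring
  have e3 : (35 + 25 * k) * P = 35 * P + 25 * (k * P) := by ring
  refine ⟨?_, ?_, ?_⟩
  · rw [hL, e1]; omega
  · rw [e2]; omega
  · rw [e3]; omega

/-! ### The word size -/

/-- The scale is below `2^{(k+3)(n+1)}`. [folklore] -/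
theorem scaleP_le_two_pow (n k : ℕ) : scaleP n k ≤ 2 ^ ((k + 3) * (n + 1)) := by
  unfold scaleP
  have h : 2 * (n + 1) ≤ 2 ^ (n + 1) := by
    rw [pow_succ]; have := Nat.lt_two_pow_self (n := n); omega
  calc (2 * (n + 1)) ^ (k + 3) ≤ (2 ^ (n + 1)) ^ (k + 3) := Nat.pow_le_pow_left h _
    _ = 2 ^ ((k + 3) * (n + 1)) := by rw [← pow_mul, Nat.mul_comm]

/-- The master inequality for the word size: a quantity `≤ A · 2^{d n} · 2^{G n}` with `A < 2^a`
fits in `(d + G + a)(n + width)` bits. [folklore] -/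
theorem lt_two_pow_wordSize {X A d G a n width : ℕ} (hX : X ≤ A * 2 ^ (d * n) * 2 ^ (G * n))
    (ha : A < 2 ^ a) (hw : 1 ≤ width) : X < 2 ^ ((d + G + a) * (n + width)) := by
  have h1 : A * 2 ^ (d * n) * 2 ^ (G * n) < 2 ^ a * 2 ^ (d * n) * 2 ^ (G * n) :=
    Nat.mul_lt_mul_of_lt_of_le (Nat.mul_lt_mul_of_lt_of_le ha le_rfl (by positivity)) le_rfl
      (by positivity)
  have h2 : 2 ^ a * 2 ^ (d * n) * 2 ^ (G * n) ≤ 2 ^ ((d + G + a) * (n + width)) := by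
    rw [← pow_add, ← pow_add]
    refine Nat.pow_le_pow_right (by norm_num) ?_
    have : (d + G + a) * (n + width) = d * n + G * n + a * width + (d + G) * width + a * n := by ring
    rw [this]
    have := Nat.le_mul_of_pos_right a hw
    omega
  exact lt_of_le_of_lt hX (lt_of_lt_of_le h1 h2)

namespace SETHBridge

variable (M : TM2ComputableAux Γ' Bool)

/-- The constant of the word-size bound. [folklore] -/
noncomputable def wconst (k c : ℕ) : ℕ :=
  (TM2Emu.enc M.tm).κ * (Complexity.TM2Comp.machinePushBound M.tm * c * (k + 5) ^ c + k + 7) + 3 * k + 330 +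
    (TM2Emu.enc M.tm).γ + TM2Emu.keyBound M.tm

/-- **The word-size multiplier `k'`** of the `k`-SAT program (word size `k' · (n + width)`), for a
machine with time bound `c · 2^{d n} · (L+1)^c`. [folklore] -/
noncomputable def wmul (k c d : ℕ) : ℕ :=
  d + (k + 3) * (c + 1) + Nat.size (wconst M k c * 2 ^ ((k + 3) * (c + 1)))

/-- **All quantities of the simulation fit in the word.** [folklore] -/
theorem word_bounds (k c d n : ℕ) {L Y T' width : ℕ} (hL : L ≤ (k + 3) * scaleP n k)
    (hY : Y + 1 ≤ (k + 5) * scaleP n k) (hT : T' ≤ c * 2 ^ (d * n) * (Y + 1) ^ c) (hw : 1 ≤ width) :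
    2 * L + 200 < 2 ^ (wmul M k c d * (n + width)) ∧
    cellAddr (2 * L + 101 + Y) (TM2Emu.enc M.tm).κ (TM2Emu.enc M.tm).κ (TM2Emu.heightBound M.tm Y T') <
      2 ^ (wmul M k c d * (n + width)) ∧
    (TM2Emu.enc M.tm).γ < 2 ^ (wmul M k c d * (n + width)) ∧
    TM2Emu.keyBound M.tm < 2 ^ (wmul M k c d * (n + width)) := by
  set P := scaleP n k with hP
  set κ := (TM2Emu.enc M.tm).κ with hκ
  set mp := Complexity.TM2Comp.machinePushBound M.tm with hmp
  set Z := 2 ^ (d * n) * P ^ (c + 1) with hZ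
  have hP1 : 1 ≤ P := Nat.one_le_pow _ _ (by omega)
  have h2d : 1 ≤ 2 ^ (d * n) := Nat.one_le_two_pow
  have hZP : P ≤ Z := by
    calc P = 1 * P ^ 1 := by ring
      _ ≤ 2 ^ (d * n) * P ^ (c + 1) := Nat.mul_le_mul h2d (Nat.pow_le_pow_right hP1 (by omega))
  have hZ1 : 1 ≤ Z := hP1.trans hZP
  have hZc : 2 ^ (d * n) * P ^ c ≤ Z := Nat.mul_le_mul_left _ (Nat.pow_le_pow_right hP1 (by omega))
  -- the core: `X ≤ wconst · Z` fits
  have hcore : ∀ X, X ≤ wconst M k c * Z → X < 2 ^ (wmul M k c d * (n + width)) := by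
    intro X hX
    refine lt_two_pow_wordSize (A := wconst M k c * 2 ^ ((k + 3) * (c + 1))) (G := (k + 3) * (c + 1))
      (hX.trans ?_) (Nat.lt_size_self _) hw
    have hPc : P ^ (c + 1) ≤ 2 ^ ((k + 3) * (c + 1)) * 2 ^ ((k + 3) * (c + 1) * n) := by
      calc P ^ (c + 1) ≤ (2 ^ ((k + 3) * (n + 1))) ^ (c + 1) := Nat.pow_le_pow_left (scaleP_le_two_pow n k) _
        _ = 2 ^ ((k + 3) * (c + 1)) * 2 ^ ((k + 3) * (c + 1) * n) := by
          rw [← pow_mul, ← pow_add]; congr 1; ring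
    calc wconst M k c * Z = wconst M k c * 2 ^ (d * n) * P ^ (c + 1) := by rw [hZ]; ring
      _ ≤ wconst M k c * 2 ^ (d * n) * (2 ^ ((k + 3) * (c + 1)) * 2 ^ ((k + 3) * (c + 1) * n)) :=
          Nat.mul_le_mul_left _ hPc
      _ = wconst M k c * 2 ^ ((k + 3) * (c + 1)) * 2 ^ (d * n) * 2 ^ ((k + 3) * (c + 1) * n) := by ring
  have hwc : wconst M k c = κ * (mp * c * (k + 5) ^ c + k + 7) + 3 * k + 330 + (TM2Emu.enc M.tm).γ +
      TM2Emu.keyBound M.tm := rfl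
  refine ⟨hcore _ ?_, hcore _ ?_, hcore _ ?_, hcore _ ?_⟩
  · -- the relocated input
    have : 2 * L + 200 ≤ (2 * k + 206) * Z := by
      calc 2 * L + 200 ≤ 2 * ((k + 3) * P) + 200 * P := by
            have := Nat.le_mul_of_pos_right 200 hP1; omega
        _ = (2 * k + 206) * P := by ring
        _ ≤ (2 * k + 206) * Z := Nat.mul_le_mul_left _ hZP
    refine this.trans (Nat.mul_le_mul_right _ ?_)
    rw [hwc]; omega
  · -- the cells of the stacks
    have hT' : T' * mp ≤ mp * c * (k + 5) ^ c * Z := by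
      calc T' * mp ≤ c * 2 ^ (d * n) * (Y + 1) ^ c * mp := Nat.mul_le_mul_right _ hT
        _ ≤ c * 2 ^ (d * n) * ((k + 5) * P) ^ c * mp :=
            Nat.mul_le_mul_right _ (Nat.mul_le_mul_left _ (Nat.pow_le_pow_left hY _))
        _ = mp * c * (k + 5) ^ c * (2 ^ (d * n) * P ^ c) := by rw [mul_pow]; ring
        _ ≤ mp * c * (k + 5) ^ c * Z := Nat.mul_le_mul_left _ hZc
    have hYZ : Y ≤ (k + 5) * Z := by
      calc Y ≤ (k + 5) * P := by omega
        _ ≤ (k + 5) * Z := Nat.mul_le_mul_left _ hZP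
    have hQ : 2 * L + 101 + Y ≤ (3 * k + 112) * Z := by
      calc 2 * L + 101 + Y ≤ 2 * ((k + 3) * P) + 101 * P + (k + 5) * P := by
            have := Nat.le_mul_of_pos_right 101 hP1; omega
        _ = (3 * k + 112) * P := by ring
        _ ≤ (3 * k + 112) * Z := Nat.mul_le_mul_left _ hZP
    have hκZ : κ ≤ κ * Z := Nat.le_mul_of_pos_right κ hZ1
    unfold cellAddr TM2Emu.heightBound
    rw [← hmp]
    calc 2 * L + 101 + Y + κ + κ * (Y + T' * mp) + κ
        ≤ (3 * k + 112) * Z + κ * Z + κ * ((k + 5) * Z + mp * c * (k + 5) ^ c * Z) + κ * Z := by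
          gcongr
      _ = (κ * (mp * c * (k + 5) ^ c + k + 7) + 3 * k + 112) * Z := by ring
      _ ≤ wconst M k c * Z := Nat.mul_le_mul_right _ (by rw [hwc]; omega)
  · calc (TM2Emu.enc M.tm).γ ≤ (TM2Emu.enc M.tm).γ * Z := Nat.le_mul_of_pos_right _ hZ1
      _ ≤ wconst M k c * Z := Nat.mul_le_mul_right _ (by rw [hwc]; omega)
  · calc TM2Emu.keyBound M.tm ≤ TM2Emu.keyBound M.tm * Z := Nat.le_mul_of_pos_right _ hZ1
      _ ≤ wconst M k c * Z := Nat.mul_le_mul_right _ (by rw [hwc]; omega)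

/-- The word-size multiplier is positive, so the input width fits in the word. [folklore] -/
theorem one_le_wmul (k c d : ℕ) : 1 ≤ wmul M k c d := by
  unfold wmul; nlinarith

/-- **The running time in the scale**: `progTime ≤ (41 k + 109 + bootCost) · P + (stepCost + 2) · T'`. [folklore] -/
theorem progTime_le {k : ℕ} {φ : CNF ℕ} (hw : φ.IsWidthLE k) (hnd : φ.Nodup) (T' : ℕ) :
    progTime M φ T' ≤ (41 * k + 109 + TM2Emu.bootCost M.tm) * scaleP φ.numVars k +
      ((TM2Emu.enc M.tm).stepCost M.tm.m + 2) * T' := by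
  obtain ⟨hL, hY, ht⟩ := kSAT_size_bounds hw hnd (codes M)
  have hP1 : 1 ≤ scaleP φ.numVars k := Nat.one_le_pow _ _ (by omega)
  have e : (41 * k + 109 + TM2Emu.bootCost M.tm) * scaleP φ.numVars k =
      7 * ((k + 3) * scaleP φ.numVars k) + (35 + 25 * k) * scaleP φ.numVars k +
        8 * scaleP φ.numVars k + 9 * ((k + 5) * scaleP φ.numVars k) +
        TM2Emu.bootCost M.tm * scaleP φ.numVars k := by ring
  have hb := Nat.le_mul_of_pos_right (TM2Emu.bootCost M.tm) hP1
  unfold progTime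
  rw [e, Nat.mul_comm (T')]
  omega

end SETHBridge

/-! ### The machine-model bridge and `SETHWordRAM → SETH` -/

/-- The real-number bookkeeping of the time bound: a step count
`t ≤ A · P + sc · T'` with `P = (2(n+1))^{k+3}`, `T' ≤ c · 2^{δ n} · (Y+1)^c` and `Y + 1 ≤ (k+5) P`
is `O(2^{δ' n})` for `δ' > δ`, with the constant assembled from the two polynomial-versus-exponential
constants `C₁`, `C₂`. [folklore] -/
theorem time_le_const_mul_two_rpow {t A sc T' P Y c k n : ℕ} {C₁ C₂ δ δ' : ℝ} (hC₁0 : 0 ≤ C₁)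
    (hC₂0 : 0 ≤ C₂) (hδ' : 0 < δ') (htime : t ≤ A * P + sc * T') (hP : P = (2 * (n + 1)) ^ (k + 3))
    (hT : (T' : ℝ) ≤ c * (2 : ℝ) ^ (δ * n) * ((Y : ℝ) + 1) ^ c) (hY : Y + 1 ≤ (k + 5) * P)
    (hC₁ : ((n : ℝ) + 1) ^ (k + 3) ≤ C₁ * (2 : ℝ) ^ (δ' * n))
    (hC₂ : ((n : ℝ) + 1) ^ ((k + 3) * c) ≤ C₂ * (2 : ℝ) ^ ((δ' - δ) * n)) :
    ((t + 1 : ℕ) : ℝ) ≤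
      ((A : ℝ) * 2 ^ (k + 3) * C₁ + ((sc * c * (k + 5) ^ c : ℕ) : ℝ) * 2 ^ ((k + 3) * c) * C₂ + 1) *
          (2 : ℝ) ^ (δ' * n) +
        ((A : ℝ) * 2 ^ (k + 3) * C₁ + ((sc * c * (k + 5) ^ c : ℕ) : ℝ) * 2 ^ ((k + 3) * c) * C₂ + 1) := by
  have hX1 : (1 : ℝ) ≤ (2 : ℝ) ^ (δ' * (n : ℝ)) := Real.one_le_rpow (by norm_num) (by positivity)
  have hPr : (P : ℝ) ≤ 2 ^ (k + 3) * C₁ * (2 : ℝ) ^ (δ' * n) := by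
    have e : (P : ℝ) = 2 ^ (k + 3) * ((n : ℝ) + 1) ^ (k + 3) := by rw [hP]; push_cast; rw [mul_pow]
    rw [e, mul_assoc]
    exact mul_le_mul_of_nonneg_left hC₁ (by positivity)
  have hPcr : (P : ℝ) ^ c ≤ 2 ^ ((k + 3) * c) * C₂ * (2 : ℝ) ^ ((δ' - δ) * n) := by
    have e : (P : ℝ) ^ c = 2 ^ ((k + 3) * c) * ((n : ℝ) + 1) ^ ((k + 3) * c) := by
      rw [hP]; push_cast; rw [← pow_mul, mul_pow]
    rw [e, mul_assoc]
    exact mul_le_mul_of_nonneg_left hC₂ (by positivity)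
  have hTr : (T' : ℝ) ≤ (c : ℝ) * (k + 5) ^ c * (2 ^ ((k + 3) * c) * C₂) * (2 : ℝ) ^ (δ' * n) := by
    have hY1 : ((Y : ℝ) + 1) ≤ (k + 5) * (P : ℝ) := by exact_mod_cast hY
    have hsplit : (2 : ℝ) ^ (δ * n) * (2 : ℝ) ^ ((δ' - δ) * n) = (2 : ℝ) ^ (δ' * n) := by
      rw [← Real.rpow_add (by norm_num)]; congr 1; ring
    calc (T' : ℝ) ≤ c * 2 ^ (δ * n) * ((Y : ℝ) + 1) ^ c := hT
      _ ≤ c * 2 ^ (δ * n) * ((k + 5) * (P : ℝ)) ^ c := by gcongr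
      _ = c * (k + 5) ^ c * (P : ℝ) ^ c * 2 ^ (δ * n) := by rw [mul_pow]; ring
      _ ≤ c * (k + 5) ^ c * (2 ^ ((k + 3) * c) * C₂ * (2 : ℝ) ^ ((δ' - δ) * n)) * 2 ^ (δ * n) := by
          gcongr
      _ = (c : ℝ) * (k + 5) ^ c * (2 ^ ((k + 3) * c) * C₂) *
            ((2 : ℝ) ^ (δ * n) * (2 : ℝ) ^ ((δ' - δ) * n)) := by ring
      _ = _ := by rw [hsplit]
  have htr : ((t + 1 : ℕ) : ℝ) ≤ (A : ℝ) * (P : ℝ) + (sc : ℝ) * (T' : ℝ) + 1 := by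
    have := (Nat.cast_le (α := ℝ)).2 htime
    push_cast at this ⊢
    linarith
  have h1 : (A : ℝ) * (P : ℝ) ≤ (A : ℝ) * 2 ^ (k + 3) * C₁ * (2 : ℝ) ^ (δ' * n) := by
    calc (A : ℝ) * (P : ℝ) ≤ (A : ℝ) * (2 ^ (k + 3) * C₁ * (2 : ℝ) ^ (δ' * n)) :=
          mul_le_mul_of_nonneg_left hPr (Nat.cast_nonneg _)
      _ = _ := by ring
  have h2 : (sc : ℝ) * (T' : ℝ) ≤
      ((sc * c * (k + 5) ^ c : ℕ) : ℝ) * 2 ^ ((k + 3) * c) * C₂ * (2 : ℝ) ^ (δ' * n) := by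
    calc (sc : ℝ) * (T' : ℝ) ≤ sc * ((c : ℝ) * (k + 5) ^ c * (2 ^ ((k + 3) * c) * C₂) * (2 : ℝ) ^ (δ' * n)) :=
          mul_le_mul_of_nonneg_left hTr (Nat.cast_nonneg _)
      _ = _ := by push_cast; ring
  have hK0 : 0 ≤ (A : ℝ) * 2 ^ (k + 3) * C₁ + ((sc * c * (k + 5) ^ c : ℕ) : ℝ) * 2 ^ ((k + 3) * c) * C₂ := by
    positivity
  nlinarith

open scoped Classical in
/-- **Turing-machine `k`-SAT algorithms are word-RAM `k`-SAT algorithms** (the folklore half of the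
robustness of SETH under the machine model; Papadimitriou 1994, §2.6; VVW ICM 2018, §2): if `k`-SAT
is decided by a multi-stack Turing machine in time `2^{δ n} · poly(L)` with `δ ≥ 0`
(`KSATInExpTime k δ`, Wave0), then for every `δ' > δ` the word-RAM problem `kSATProblem k` is
decided within `⌊C · 2^{δ' n} + C⌋₊` steps with `Θ(n)`-bit words (`KSATInRAMTime k δ'`). The
program relocates and transcodes its input, simulates the machine with constant overhead per step
(`TM2Emu.simProgram_exec`) and reads off the answer; the `poly(L) = poly_k(n)` factor (no repeated
clauses) is absorbed by `2^{(δ'-δ) n}`. [folklore] -/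
theorem kSATInRAMTime_of_kSATInExpTime_of_nonneg {k : ℕ} {δ δ' : ℝ} (hδ0 : 0 ≤ δ) (hδ : δ < δ')
    (h : KSATInExpTime k δ) : KSATInRAMTime k δ' := by
  obtain ⟨T, ⟨c, hc⟩, M, hM⟩ := h
  have hδ' : 0 < δ' := lt_of_le_of_lt hδ0 hδ
  set d : ℕ := ⌈δ⌉₊ with hd
  obtain ⟨C₁, hC₁0, hC₁⟩ := exists_pow_le_two_rpow (k + 3) hδ'
  obtain ⟨C₂, hC₂0, hC₂⟩ := exists_pow_le_two_rpow ((k + 3) * c) (sub_pos.2 hδ)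
  -- the machine constants, made opaque for the real arithmetic
  obtain ⟨bc, hbc⟩ : ∃ bc : ℕ, TM2Emu.bootCost M.tm = bc := ⟨_, rfl⟩
  obtain ⟨sc, hsc⟩ : ∃ sc : ℕ, (TM2Emu.enc M.tm).stepCost M.tm.m = sc := ⟨_, rfl⟩
  refine ⟨(SETHBridge.prog M).toProgram, SETHBridge.wmul M k c d,
    ((41 * k + 109 + bc : ℕ) : ℝ) * 2 ^ (k + 3) * C₁ +
      (((sc + 2) * c * (k + 5) ^ c : ℕ) : ℝ) * 2 ^ ((k + 3) * c) * C₂ + 1,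
    SProg.toProgram_isDeterministic _, SProg.toProgram_isOracleFree (SETHBridge.prog_queryFree M),
    fun φ => ?_⟩
  obtain ⟨φ, hwid, hnd⟩ := φ
  -- the machine's run on `φ`
  have hrun := hM (toKCNF k φ hwid)
  set n := φ.numVars with hn
  set Y := ((SETHBridge.codes M).cnfCodes φ).length with hYdef
  have hleny : Y = (KCNF.encode (toKCNF k φ hwid)).length := by
    rw [hYdef, SETHBridge.cnfCodes_eq_map_inp M φ hwid, List.length_map, SETHBridge.inp,
      List.length_map]
  set T' := T n Y with hT'
  have hrun' : Nonempty (TM2OutputsInTime M.tm (SETHBridge.inp M φ hwid)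
      (some ((encodeBool (decide (toKCNF k φ hwid).Satisfiable)).map M.outputAlphabet.symm)) T') := by
    rw [hT', hleny]; exact hrun
  -- sizes
  obtain ⟨hLb, hYb, htb⟩ := kSAT_size_bounds hwid hnd (SETHBridge.codes M)
  rw [← hn] at hLb hYb
  rw [← hYdef] at hYb
  set P := scaleP n k with hP
  -- the machine's time, as a natural number (for the word size) and as a real number (for the time)
  have hcr := hc n Y
  rw [← hT'] at hcr
  have hTn : T' ≤ c * 2 ^ (d * n) * (Y + 1) ^ c := by
    have h2 : (2 : ℝ) ^ (δ * n) ≤ (2 : ℝ) ^ ((d : ℝ) * n) :=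
      Real.rpow_le_rpow_of_exponent_le (by norm_num)
        (mul_le_mul_of_nonneg_right (Nat.le_ceil δ) (Nat.cast_nonneg _))
    have h3 : (2 : ℝ) ^ ((d : ℝ) * n) = ((2 ^ (d * n) : ℕ) : ℝ) := by
      rw [← Nat.cast_mul, Real.rpow_natCast]; push_cast; ring
    have : (T' : ℝ) ≤ ((c * 2 ^ (d * n) * (Y + 1) ^ c : ℕ) : ℝ) := by
      calc (T' : ℝ) ≤ c * 2 ^ (δ * n) * ((Y : ℝ) + 1) ^ c := hcr
        _ ≤ c * 2 ^ ((d : ℝ) * n) * ((Y : ℝ) + 1) ^ c := by gcongr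
        _ = _ := by rw [h3]; push_cast; ring
    exact_mod_cast this
  -- the word size
  have hwid1 : 1 ≤ inputWidth (encodeCNFWords φ) := inputWidth_pos _
  obtain ⟨hw1, hw2, hw3, hw4⟩ := SETHBridge.word_bounds M k c d n hLb hYb hTn hwid1
  have hwI : inputWidth (encodeCNFWords φ) ≤
      SETHBridge.wmul M k c d * (n + inputWidth (encodeCNFWords φ)) := by
    have := SETHBridge.one_le_wmul M k c d
    calc inputWidth (encodeCNFWords φ) = 1 * inputWidth (encodeCNFWords φ) := (one_mul _).symm
      _ ≤ SETHBridge.wmul M k c d * (n + inputWidth (encodeCNFWords φ)) :=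
          Nat.mul_le_mul this (Nat.le_add_left _ _)
  -- the run of the program
  obtain ⟨st', ⟨t, ht, hex⟩, hout⟩ := SETHBridge.prog_exec M φ hwid hrun' hwI hw1 hw2 hw3 hw4
  refine ⟨readOut st'.mem, ?_, SProg.outputsWithin_toProgram hex ?_ zeroCoins⟩
  · rw [hout]
    exact (CNFSAT_good_iff φ _).2 rfl
  · -- the time bound
    have htime := (ht.trans (SETHBridge.progTime_le M hwid hnd T'))
    rw [← hn, ← hP, hbc, hsc] at htime
    refine Nat.le_floor ?_
    exact time_le_const_mul_two_rpow hC₁0 hC₂0 hδ' htime hP hcr hYb (hC₁ n) (hC₂ n)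

/-- **`SETHWordRAM → SETH`** (discharge of the named fact `seth_of_sethWordRAM`: word-RAM SETH
implies Wave0's Turing-machine SETH, "a fast Turing-machine algorithm is a fast RAM algorithm";
folklore, Papadimitriou 1994, §2.6; VVW ICM 2018, §2). Given `ε > 0`, apply word-RAM SETH with
`ε' = min (ε/2) (1/2)`; a Turing-machine `k`-SAT algorithm with exponent `1 - ε` has exponent
`max (1 - ε) 0 < 1 - ε'` and yields a word-RAM algorithm with exponent `1 - ε'`
(`kSATInRAMTime_of_kSATInExpTime_of_nonneg`). [folklore] -/
theorem seth_of_sethWordRAM_holds : seth_of_sethWordRAM := by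
  intro h ε hε
  set ε' : ℝ := min (ε / 2) (1 / 2) with hε'
  have hε'0 : 0 < ε' := lt_min (half_pos hε) (by norm_num)
  obtain ⟨k, hk, hnot⟩ := h ε' hε'0
  refine ⟨k, hk, fun hTM => hnot ?_⟩
  have hmono : KSATInExpTime k (max (1 - ε) 0) := by
    obtain ⟨T, ⟨c, hc⟩, hrest⟩ := hTM
    refine ⟨T, ⟨c, fun n L => (hc n L).trans ?_⟩, hrest⟩
    gcongr
    · norm_num
    · exact le_max_left _ _
  refine kSATInRAMTime_of_kSATInExpTime_of_nonneg (le_max_right _ _) ?_ hmono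
  have h1 : ε' ≤ ε / 2 := min_le_left _ _
  have h2 : ε' ≤ 1 / 2 := min_le_right _ _
  rcases le_or_gt (1 - ε) 0 with h0 | h0
  · rw [max_eq_right h0]; linarith
  · rw [max_eq_left h0.le]; linarith

/-- **Negative exponents are vacuous**: no Turing machine decides `k`-SAT in time
`2^{δ n} · poly(L)` with `δ < 0`, because on the formulas with `n` variables and no clause the
budget `c · 2^{δ n} · (L + 1)^c` (`L ≤ n + 1`) drops below one step for large `n`, while the initial
configuration is not halting. [folklore] -/
theorem not_kSATInExpTime_of_neg {k : ℕ} {δ : ℝ} (hδ : δ < 0) : ¬ KSATInExpTime k δ := by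
  rintro ⟨T, ⟨c, hc⟩, M, hM⟩
  -- a vanishing budget
  obtain ⟨C₃, hC₃0, hC₃⟩ := exists_pow_le_two_rpow c (ε := -δ / 2) (by linarith)
  set K : ℝ := (c : ℝ) * 2 ^ c * C₃ with hK
  have hK0 : 0 ≤ K := by positivity
  set r : ℝ := (2 : ℝ) ^ (δ / 2) with hr
  have hr0 : 0 < r := Real.rpow_pos_of_pos (by norm_num) _
  have hr1 : r < 1 := Real.rpow_lt_one_of_one_lt_of_neg (by norm_num) (by linarith)
  obtain ⟨N, hN⟩ := exists_pow_lt_of_lt_one (show (0 : ℝ) < 1 / (K + 1) by positivity) hr1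
  -- the instance with `N` variables and no clause
  let φ : KCNF k := ⟨N, [], by simp, by simp⟩
  have hL : (φ.encode.length : ℝ) + 1 ≤ 2 * ((N : ℝ) + 1) := by
    have h1 : φ.encode.length = (encodeNat N).length + 1 := by
      simp [KCNF.encode, φ]
    have h2 : (encodeNat N).length ≤ N := by
      rw [encodeNat_eq_natBits]; exact length_natBits_le_self N
    have h3 : φ.encode.length ≤ N + 1 := by rw [h1]; omega
    have : (φ.encode.length : ℝ) ≤ N + 1 := by exact_mod_cast h3
    linarith
  have hbudget : (T φ.numVars φ.encode.length : ℝ) < 1 := by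
    have hn : φ.numVars = N := rfl
    have h1 := hc φ.numVars φ.encode.length
    rw [hn] at h1 ⊢
    have hpow : ((φ.encode.length : ℝ) + 1) ^ c ≤ 2 ^ c * (C₃ * (2 : ℝ) ^ (-δ / 2 * N)) := by
      calc ((φ.encode.length : ℝ) + 1) ^ c ≤ (2 * ((N : ℝ) + 1)) ^ c := by gcongr
        _ = 2 ^ c * ((N : ℝ) + 1) ^ c := mul_pow _ _ _
        _ ≤ 2 ^ c * (C₃ * (2 : ℝ) ^ (-δ / 2 * N)) := mul_le_mul_of_nonneg_left (hC₃ N) (by positivity)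
    have hsplit : (2 : ℝ) ^ (δ * N) * (2 : ℝ) ^ (-δ / 2 * N) = r ^ N := by
      rw [← Real.rpow_add (by norm_num), hr, ← Real.rpow_mul_natCast (by norm_num)]
      congr 1; ring
    have hKr : K * r ^ N < 1 := by
      have := mul_lt_mul_of_pos_left hN (show (0 : ℝ) < K + 1 by positivity)
      rw [mul_one_div_cancel (by positivity)] at this
      nlinarith [pow_pos hr0 N]
    calc (T N φ.encode.length : ℝ) ≤ c * 2 ^ (δ * N) * ((φ.encode.length : ℝ) + 1) ^ c := h1
      _ ≤ c * 2 ^ (δ * N) * (2 ^ c * (C₃ * (2 : ℝ) ^ (-δ / 2 * N))) := by gcongr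
      _ = K * ((2 : ℝ) ^ (δ * N) * (2 : ℝ) ^ (-δ / 2 * N)) := by rw [hK]; ring
      _ = K * r ^ N := by rw [hsplit]
      _ < 1 := hKr
  have hT0 : T φ.numVars φ.encode.length = 0 := by exact_mod_cast Nat.lt_one_iff.1 (by exact_mod_cast hbudget)
  -- no run of `0` steps from the initial to the halting configuration
  obtain ⟨⟨⟨s, hs⟩, hle⟩⟩ := hM φ
  have hs0 : s = 0 := by
    have : s ≤ T φ.numVars φ.encode.length := hle
    omega
  subst hs0
  simp only [Function.iterate_zero, id_eq, Option.map_some, Option.some.injEq] at hs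
  have := congrArg TM2.Cfg.l hs
  simp [initList, haltList] at this

/-- **Discharge of the named fact `kSATInRAMTime_of_kSATInExpTime`** (Turing-machine `k`-SAT
algorithms with exponent `δ` are word-RAM `k`-SAT algorithms with every exponent `δ' > δ`): for
`δ ≥ 0` this is `kSATInRAMTime_of_kSATInExpTime_of_nonneg`, and for `δ < 0` the hypothesis is
vacuous (`not_kSATInExpTime_of_neg`). [folklore] -/
theorem kSATInRAMTime_of_kSATInExpTime_holds : kSATInRAMTime_of_kSATInExpTime := by
  intro k δ δ' h hδ
  rcases le_or_gt 0 δ with h0 | h0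
  · exact kSATInRAMTime_of_kSATInExpTime_of_nonneg h0 hδ h
  · exact absurd h (not_kSATInExpTime_of_neg h0)

end Literature.Computability.FineGrained

/-!
## Discharge of `not_sethWordRAM_of_kDominatingSet_inTimeO` (fine-grained.S18; appended)

**`not_sethWordRAM_of_kDominatingSet_inTimeO_holds`** — Pătraşcu–Williams, *On the possibility of
faster SAT algorithms*, Proc. SODA 2010, §2: Hypothesis 1 ("There exist `k ≥ 3` and `ε ∈ (0, k)`
such that `k`-Dominating Set is in `O(n^{k-ε})` time"), **Thm. 2.1** ("Hypothesis 1 implies that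
CNF-SAT has an improved algorithm", i.e. one running in `2^{δ n} poly(m)` time for a constant
`δ < 1`), proved as a special case of **Lemma 2.1** (p. 1068: "Suppose there is an integer `k ≥ 3`
and function `f` such that `k`-Dominating Set is solvable in `O(n^{f(k)})` time. Then CNF-SAT is in
`O((m + k 2^{n/k})^{f(k)})` time"; the statement file's locator "Thm. 1.2" denotes this Thm. 2.1).
The printed proof — `k` groups of `n/k` variables, a clique on the `2^{n/k}` partial assignments of
each group, `m` clause nodes joined to the partial assignments satisfying them, one dummy node per
clique; `k`-dominating set iff satisfiable; `k 2^{n/k} + m + k` nodes — is carried out at machine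
level, in the one machine model of the statement (the word RAM), by
`Literature.Computability.FineGrained.DomSetSETHGraph` (the graph and its correctness,
`hasDominatingSetOfCard_pwMatrix_iff`) and `Literature.Computability.FineGrained.DomSetSETHReductionProgram`
(the word-RAM program building its adjacency matrix around one emulated run of the hypothetical
dominating-set program, its verification, word size and time analysis). Here:

* `kSATInRAMTime_of_kDominatingSet_inTimeO` (Lemma 2.1 specialised to `k`-CNFs, where
  `m ≤ (2(n+1))^{k+1}` by `numClauses_le_of_nodup`, so that `poly(m)` is `poly(n)`): an
  `O(N^{K-ε})` word-RAM algorithm for `K`-Dominating Set (`K ≥ 3`, `0 < ε ≤ 1`) puts every `k`-SAT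
  in word-RAM time `O(2^{(1 - ε/(2K)) n})`;
* the discharge: shrink `ε` below `1` (`inTimeO_rpow_sub_anti`) and apply word-RAM SETH at
  `ε/(2K)` — its `k` is then decided too fast.
-/

namespace Literature.Computability.FineGrained

open Cryptography Cryptography.WordRAM Complexity

/-- A floored affine bound is at most the same affine form with `|C|` (any sign of `C`). [folklore] -/
theorem DomSetRed.floor_affine_le (C x : ℝ) (hx : 0 ≤ x) :
    ((⌊C * x + C⌋₊ : ℕ) : ℝ) ≤ |C| * x + |C| := by
  have hC : C ≤ |C| := le_abs_self C
  have h0 : 0 ≤ |C| * x + |C| := by positivity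
  rcases le_or_gt 0 (C * x + C) with h | h
  · calc ((⌊C * x + C⌋₊ : ℕ) : ℝ) ≤ C * x + C := Nat.floor_le h
      _ ≤ |C| * x + |C| := by nlinarith
  · rw [Nat.floor_of_nonpos h.le]; simpa using h0

/-- **Pătraşcu–Williams, Thm. 2.1 / Lemma 2.1, on the word RAM.** If for some `K ≥ 3` and
`0 < ε ≤ 1` the `K`-Dominating Set problem on `N`-vertex graphs (`kDominatingSet K`) has a
deterministic word-RAM algorithm running in time `O(N^{K-ε})`, then for every `k`, `k`-SAT
(`kSATProblem k`: width `≤ k`, no repeated clause) is decided on the deterministic word RAM in time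
`O(2^{(1 - ε/(2K)) n})` (`KSATInRAMTime k (1 - ε/(2K))`): run the reduction program
`DomSetRed.reduction` (`DomSetRed.Params.reduction_outputsWithin`) — relocation, constants, the
adjacency matrix of the Pătraşcu–Williams graph (`hasDominatingSetOfCard_pwMatrix_iff`), one emulated
run of the dominating-set program, read-out — at word size `kfit · (n + width)`
(`DomSetRed.Params.fits`); with `N ≤ (3K + m) 2^{n/K}` and `m ≤ (2(n+1))^{k+1}`
(`numClauses_le_of_nodup`) the build costs `O(Lx + N²) = poly(n) 2^{(1-ε/K) n}`
(`DomSetRed.Params.Tpre_le`, `.N_sq_le`), the emulated run `38 ⌊C N^{K-ε} + C⌋ =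
poly(n) 2^{(1-ε/K) n}` (`.N_rpow_le`), and `poly(n) ≤ C₁ 2^{(ε/(2K)) n}` (`exists_pow_le_two_rpow`).
This is Lemma 2.1 of the source (`CNF-SAT ∈ O((m + k 2^{n/k})^{k-ε})`) specialised to `k`-CNFs.
[cite: PatrascuWilliams2010, §2 Thm. 2.1 and Lemma 2.1 (p. 1068)] -/
theorem kSATInRAMTime_of_kDominatingSet_inTimeO {K : ℕ} (hK : 3 ≤ K) {ε : ℝ} (hε : 0 < ε)
    (hε1 : ε ≤ 1) (h : (kDominatingSet K).InTimeO fun n => (n : ℝ) ^ ((K : ℝ) - ε)) (k : ℕ) :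
    KSATInRAMTime k (1 - ε / (2 * K)) := by
  classical
  obtain ⟨C, M, kM, hdet, hof, hM⟩ := h
  have hK1 : 1 ≤ K := by omega
  have hKpos : (0 : ℝ) < K := by exact_mod_cast (show 0 < K by omega)
  -- the polynomial-vs-exponential constant
  have hε2K : 0 < ε / (2 * K) := by positivity
  obtain ⟨C₁, hC₁0, hC₁⟩ := exists_pow_le_two_rpow ((k + 1) * K) hε2K
  -- the program and the constants
  set cM := M.maxConst with hcM
  set A : ℝ := (3 * (K : ℝ) + 2 ^ (k + 1)) ^ K with hA
  have hA0 : 0 ≤ A := by positivity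
  set D : ℝ := (7 * (k + 3) + (18 * k + 32) + 38 * |C|) * A * C₁ + 148 + 38 * |C| with hD
  refine ⟨DomSetRed.reduction M K kM, DomSetRed.Params.kfit K kM cM, D,
    DomSetRed.reduction_isDeterministic M K kM, DomSetRed.reduction_isOracleFree M K kM, fun φ => ?_⟩
  -- one instance
  obtain ⟨hw, hnd⟩ := φ.2
  set g : DomSetRed.Params := ⟨φ.1, K, kM, cM⟩ with hgdef
  have hsize : (kSATProblem k).size φ = g.n := rfl
  have hwidth : (kSATProblem k).width φ = inputWidth g.x := rfl
  have henc : (kSATProblem k).encode φ = g.x := rfl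
  rw [hsize, hwidth, henc]
  have hF := g.fits hK1
  -- the dominating-set program on the Pătraşcu–Williams instance
  obtain ⟨out, hout, hMrun⟩ := hM (pwInstance g.φ g.K)
  rw [kDominatingSet_good_pwInstance hK1, Set.mem_singleton_iff] at hout
  subst hout
  have hws : kM * (kDominatingSet g.K).width (pwInstance g.φ g.K) = g.ws := by
    rw [kDominatingSet_width_pwInstance, ← g.N_eq, sq]; rfl
  rw [hws] at hMrun
  have hred := g.reduction_outputsWithin hF hK1 hw hdet hof rfl hMrun
  refine ⟨_, (kSATProblem_good_iff φ _).2 rfl, hred.mono ?_⟩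
  -- the time bound
  have hm : g.m ≤ (2 * (g.n + 1)) ^ (k + 1) := numClauses_le_of_nodup hw hnd
  set n := g.n with hn
  apply Nat.le_floor
  unfold DomSetRed.Params.Ttotal
  push_cast
  have hcs : (cstep : ℝ) = 38 := by norm_num [cstep]
  rw [hcs, kDominatingSet_size_pwInstance, ← g.N_eq]
  -- the pieces
  have hn0 : (0 : ℝ) ≤ n := Nat.cast_nonneg _
  set Y : ℝ := (2 : ℝ) ^ ((1 - ε / K) * n) with hY
  have hY1 : 1 ≤ Y := Real.one_le_rpow one_le_two (by
    apply mul_nonneg _ hn0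
    rw [sub_nonneg, div_le_one hKpos]; linarith [show (3 : ℝ) ≤ K by exact_mod_cast hK])
  set Q : ℝ := 3 * (K : ℝ) + g.m with hQ
  have hQ1 : 1 ≤ Q := g.one_le_Q hK1
  have hQK1 : 1 ≤ Q ^ K := one_le_pow₀ hQ1
  have hQA : Q ^ K ≤ A * ((n : ℝ) + 1) ^ ((k + 1) * K) := g.Q_pow_le hm
  have hpoly : ((n : ℝ) + 1) ^ ((k + 1) * K) ≤ C₁ * (2 : ℝ) ^ (ε / (2 * K) * n) := hC₁ n
  have hNε : (g.N : ℝ) ^ ((K : ℝ) - ε) ≤ Q ^ K * Y :=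
    g.N_rpow_le hK1 hε (by linarith [show (3 : ℝ) ≤ K by exact_mod_cast hK])
  have hN2 : (g.N : ℝ) ^ 2 ≤ Q ^ K * Y := g.N_sq_le hK hε1
  have hT : ((⌊C * (g.N : ℝ) ^ ((K : ℝ) - ε) + C⌋₊ : ℕ) : ℝ) ≤ |C| * (Q ^ K * Y) + |C| := by
    refine (DomSetRed.floor_affine_le C _ (Real.rpow_nonneg (Nat.cast_nonneg _) _)).trans ?_
    gcongr
  have hLx : (g.Lx : ℝ) ≤ (k + 3) * (Q ^ K * Y) := by
    have h1 : ((g.Lx : ℕ) : ℝ) ≤ ((2 + (k + 1) * g.m : ℕ) : ℝ) := by exact_mod_cast g.Lx_le hw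
    push_cast at h1
    have hm0 : (0 : ℝ) ≤ g.m := Nat.cast_nonneg _
    have hmQ : (g.m : ℝ) ≤ Q := by rw [hQ]; linarith [hKpos]
    have hQY : Q ≤ Q ^ K * Y := by
      calc Q = Q ^ 1 * 1 := by ring
        _ ≤ Q ^ K * Y := mul_le_mul (pow_le_pow_right₀ hQ1 hK1) hY1 zero_le_one (by positivity)
    nlinarith
  have hTpre : (g.Tpre k : ℝ) ≤ 7 * g.Lx + (18 * k + 32) * (g.N : ℝ) ^ 2 + 144 := by
    have : ((g.Tpre k : ℕ) : ℝ) ≤ ((7 * g.Lx + (18 * k + 32) * (g.N * g.N) + 144 : ℕ) : ℝ) := by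
      exact_mod_cast g.Tpre_le hK1 k
    push_cast at this; rw [sq]; linarith
  -- polynomial absorbed
  have hexp : (2 : ℝ) ^ (ε / (2 * K) * n) * Y = (2 : ℝ) ^ ((1 - ε / (2 * K)) * n) := by
    rw [hY, ← Real.rpow_add (by norm_num)]; congr 1; field_simp; ring
  have hQY : Q ^ K * Y ≤ A * C₁ * (2 : ℝ) ^ ((1 - ε / (2 * K)) * n) := by
    calc Q ^ K * Y ≤ (A * ((n : ℝ) + 1) ^ ((k + 1) * K)) * Y := by gcongr
      _ ≤ (A * (C₁ * (2 : ℝ) ^ (ε / (2 * K) * n))) * Y := by gcongr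
      _ = A * C₁ * ((2 : ℝ) ^ (ε / (2 * K) * n) * Y) := by ring
      _ = A * C₁ * (2 : ℝ) ^ ((1 - ε / (2 * K)) * n) := by rw [hexp]
  set Z : ℝ := (2 : ℝ) ^ ((1 - ε / (2 * K)) * n) with hZ
  have hZ0 : 0 ≤ Z := by positivity
  have habs : 0 ≤ |C| := abs_nonneg C
  -- the final (linear) assembly, products kept as atoms
  set Wc : ℝ := 7 * ((k : ℝ) + 3) + (18 * k + 32) + 38 * |C| with hWc
  have hWc0 : 0 ≤ Wc := by positivity
  have e1 : (7 : ℝ) * g.Lx ≤ 7 * ((k + 3) * (Q ^ K * Y)) := by linarith [hLx]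
  have e2 : (18 * (k : ℝ) + 32) * (g.N : ℝ) ^ 2 ≤ (18 * (k : ℝ) + 32) * (Q ^ K * Y) :=
    mul_le_mul_of_nonneg_left hN2 (by positivity)
  have e3 : (38 : ℝ) * ((⌊C * (g.N : ℝ) ^ ((K : ℝ) - ε) + C⌋₊ : ℕ) : ℝ) ≤
      38 * (|C| * (Q ^ K * Y)) + 38 * |C| := by linarith [hT]
  have e5 : 7 * (((k : ℝ) + 3) * (Q ^ K * Y)) + (18 * (k : ℝ) + 32) * (Q ^ K * Y) +
      38 * (|C| * (Q ^ K * Y)) = Wc * (Q ^ K * Y) := by rw [hWc]; ring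
  have e4 : Wc * (Q ^ K * Y) ≤ Wc * (A * C₁ * Z) := mul_le_mul_of_nonneg_left hQY hWc0
  have e6 : Wc * (A * C₁ * Z) = (Wc * A * C₁) * Z := by ring
  have h1 : Wc * A * C₁ ≤ D := by
    rw [hD, hWc]; linarith [habs]
  have h2 : (148 : ℝ) + 38 * |C| ≤ D := by
    have hW0 : 0 ≤ Wc * A * C₁ := by positivity
    rw [hD]; rw [hWc] at hW0; linarith
  have h3 : (Wc * A * C₁) * Z ≤ D * Z := mul_le_mul_of_nonneg_right h1 hZ0
  linarith [hTpre, e1, e2, e3, e5, e4, e6, h3, h2]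

/-- **fine-grained.S18, discharged** (Pătraşcu–Williams, SODA 2010, §2, Thm. 2.1 via Lemma 2.1,
p. 1068; locator "Thm. 1.2" in the statement file). If for some `k ≥ 3` and `ε > 0` the
`k`-Dominating Set problem on `n`-vertex graphs is solvable in `O(n^{k-ε})` time on the word RAM,
then word-RAM SETH fails: shrink `ε` to `min ε 1` (`inTimeO_rpow_sub_anti`: an `O(n^{k-ε})` bound is
an `O(n^{k - min ε 1})` bound), let `SETHWordRAM` provide its width `k'` for the saving
`min ε 1 / (2k)`, and decide `k'`-SAT too fast by `kSATInRAMTime_of_kDominatingSet_inTimeO`.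
[cite: PatrascuWilliams2010, §2 Thm. 2.1 (with Lemma 2.1, p. 1068)] -/
theorem not_sethWordRAM_of_kDominatingSet_inTimeO_holds : not_sethWordRAM_of_kDominatingSet_inTimeO := by
  rintro ⟨K, hK, ε, hε, h⟩ hS
  have hKpos : (0 : ℝ) < K := by exact_mod_cast (show 0 < K by omega)
  have hε₁ : 0 < min ε 1 := lt_min hε one_pos
  have h₁ : (kDominatingSet K).InTimeO fun n => (n : ℝ) ^ ((K : ℝ) - min ε 1) :=
    inTimeO_rpow_sub_anti (min_le_left _ _) h
  obtain ⟨k, -, hk⟩ := hS (min ε 1 / (2 * K)) (by positivity)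
  exact hk (kSATInRAMTime_of_kDominatingSet_inTimeO hK hε₁ (min_le_right _ _) h₁ k)

end Literature.Computability.FineGrained
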